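import Mathlib
import Summits.AnomalousDissipation.AnomalousDissipation.Theorems.SoloBlindGainAlgebra

/-!
# SoloBlind — entrywise resolvent domination and the product-entrywise cell increment (ENGINE L, PLAN §125.4, kernel K-ENT′)

`SoloBlindGainAlgebra` (#252) covers a parameter cell of LEMMA P by *scalar* shifts `T' = T + μ•1` and a
multiplicative gain bound.  The folded chain matrices of ENGINE L are in fact perturbed *diagonally*
(the continued-fraction tail on the fold row moves with the shift, PLAN §125.2), and in the deep band the
multiplicative bound is far from sharp (PLAN §125.3).  This file proves the finite-matrix algebra behind the
engine's PRODUCT-ENTRYWISE increment `[E′]`, with no Neumann series and no limits: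

* `cabs A` (entrywise absolute values), the entrywise order `RLe`, `RNonneg`, and the real weighted gain
  `RGain w K θ := ∀ m, ∑ j, K m j * w j ≤ θ * w m`; `gain_iff` identifies `Gain w A q` with `RGain w (cabs A) q`;
* `rnonneg_of_mul_le` : if `K ≥ 0` has weighted gain `θ < 1` and `K W ≤ W` entrywise then `W ≥ 0`
  (a finite maximum-principle replacing the convergence of `∑ Kⁿ`);
* `isUnit_add_of_dom` : `S T = 1`, `|S| ≤ U`, `|E| ≤ D`, `RGain w ((U D)^N) θ`, `θ < 1` ⇒ `T + E` is invertible;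
* `cabs_inv_add_le` : with moreover `U D + U D X ≤ X` entrywise and `(T + E) S' = 1`:
  `|S'| ≤ (1 + X) U` entrywise;
* `loop_diff_eq` / `cabs_loop_diff_le` : for `L = S H R E`, `L' = S' H R' E` with `S' (T_s + E_s) = 1`,
  `(T_r + E_r) R' = 1`, `E F = 1`:  `L' - L = -(S' E_s L) + S' E_s L Z - L Z`, `Z = F E_r R' E`, hence
  `|L' - L| ≤ Y_s D_s U_L + Y_s D_s U_L Z_b + U_L Z_b` entrywise (`|S'| ≤ Y_s`, `|R'| ≤ Y_r`, `|L| ≤ U_L`,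
  `Z_b = |F| D_r Y_r |E|`), and `gain_loop_cell` : `Gain w L' q'` whenever `RGain w (U_L + that bound) q'`.

The engine supplies `U, D, X, N, θ, Y, U_L` as certified nonnegative tables; these theorems turn them into
the invertibility of the shifted chains and the gain bound of the loop matrix on the whole cell.
-/

namespace Summit.AnomalousDissipation.SoloBlind.GainEntrywise

open Finset Matrix
open Summit.AnomalousDissipation.SoloBlind.GainAlgebra (Gain)

section Basic

variable {ι κ ν : Type*}

/-- Entrywise absolute values of a complex matrix. -/
noncomputable def cabs (A : Matrix ι κ ℂ) : Matrix ι κ ℝ := fun i j => ‖A i j‖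

/-- Entrywise order on real matrices. -/
def RLe (U V : Matrix ι κ ℝ) : Prop := ∀ i j, U i j ≤ V i j

/-- Entrywise nonnegativity of a real matrix. -/
def RNonneg (U : Matrix ι κ ℝ) : Prop := ∀ i j, 0 ≤ U i j

/-- Entries of `cabs`. -/
@[simp] theorem cabs_apply (A : Matrix ι κ ℂ) (i : ι) (j : κ) : cabs A i j = ‖A i j‖ := rfl

/-- `cabs A` is entrywise nonnegative. -/
theorem cabs_nonneg (A : Matrix ι κ ℂ) : RNonneg (cabs A) := fun _ _ => norm_nonneg _

/-- Reflexivity of the entrywise order. -/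
theorem rle_refl (U : Matrix ι κ ℝ) : RLe U U := fun _ _ => le_rfl

/-- Transitivity of the entrywise order. -/
theorem RLe.trans {U V W : Matrix ι κ ℝ} (h1 : RLe U V) (h2 : RLe V W) : RLe U W :=
  fun i j => (h1 i j).trans (h2 i j)

/-- The entrywise order is compatible with addition. -/
theorem RLe.add {U V U' V' : Matrix ι κ ℝ} (h1 : RLe U V) (h2 : RLe U' V') :
    RLe (U + U') (V + V') := fun i j => by
  rw [Matrix.add_apply, Matrix.add_apply]; exact add_le_add (h1 i j) (h2 i j)

/-- A matrix above a nonnegative one is nonnegative. -/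
theorem rnonneg_of_rle {U V : Matrix ι κ ℝ} (hU : RNonneg U) (h : RLe U V) : RNonneg V :=
  fun i j => (hU i j).trans (h i j)

/-- A dominating table is nonnegative. -/
theorem rnonneg_of_dom {A : Matrix ι κ ℂ} {U : Matrix ι κ ℝ} (h : RLe (cabs A) U) : RNonneg U :=
  rnonneg_of_rle (cabs_nonneg A) h

/-- `cabs (-A) = cabs A`. -/
theorem cabs_neg (A : Matrix ι κ ℂ) : cabs (-A) = cabs A := by
  ext i j; simp [cabs]

/-- Entrywise triangle inequality. -/
theorem cabs_add_le (A B : Matrix ι κ ℂ) : RLe (cabs (A + B)) (cabs A + cabs B) := fun i j => by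
  simp only [cabs_apply, Matrix.add_apply]; exact norm_add_le _ _

/-- Entrywise triangle inequality for a difference. -/
theorem cabs_sub_le (A B : Matrix ι κ ℂ) : RLe (cabs (A - B)) (cabs A + cabs B) := by
  rw [sub_eq_add_neg]
  have h := cabs_add_le A (-B)
  rwa [cabs_neg] at h

/-- `|A B| ≤ |A| |B|` entrywise. -/
theorem cabs_mul_le [Fintype κ] (A : Matrix ι κ ℂ) (B : Matrix κ ν ℂ) : RLe (cabs (A * B)) (cabs A * cabs B) := by
  intro i j
  simp only [cabs_apply, Matrix.mul_apply]
  calc ‖∑ k, A i k * B k j‖ ≤ ∑ k, ‖A i k * B k j‖ := norm_sum_le _ _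
    _ = ∑ k, ‖A i k‖ * ‖B k j‖ := sum_congr rfl fun k _ => norm_mul _ _
    _ = ∑ k, cabs A i k * cabs B k j := rfl

/-- Left multiplication by a nonnegative matrix is monotone. -/
theorem mul_mono_left [Fintype κ] {A : Matrix ι κ ℝ} {B C : Matrix κ ν ℝ} (hA : RNonneg A) (h : RLe B C) :
    RLe (A * B) (A * C) := fun i j => by
  simp only [Matrix.mul_apply]
  exact sum_le_sum fun k _ => mul_le_mul_of_nonneg_left (h k j) (hA i k)

/-- Right multiplication by a nonnegative matrix is monotone. -/
theorem mul_mono_right [Fintype κ] {A B : Matrix ι κ ℝ} {C : Matrix κ ν ℝ} (h : RLe A B) (hC : RNonneg C) :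
    RLe (A * C) (B * C) := fun i j => by
  simp only [Matrix.mul_apply]
  exact sum_le_sum fun k _ => mul_le_mul_of_nonneg_right (h i k) (hC k j)

/-- Products of nonnegative matrices are nonnegative. -/
theorem rnonneg_mul [Fintype κ] {A : Matrix ι κ ℝ} {B : Matrix κ ν ℝ} (hA : RNonneg A) (hB : RNonneg B) :
    RNonneg (A * B) := fun i j => by
  simp only [Matrix.mul_apply]
  exact sum_nonneg fun k _ => mul_nonneg (hA i k) (hB k j)

/-- Sums of nonnegative matrices are nonnegative. -/
theorem rnonneg_add {A B : Matrix ι κ ℝ} (hA : RNonneg A) (hB : RNonneg B) : RNonneg (A + B) :=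
  fun i j => by rw [Matrix.add_apply]; exact add_nonneg (hA i j) (hB i j)

/-- Domination is stable under products: `|A| ≤ A'`, `|B| ≤ B'` give `|A B| ≤ A' B'`. -/
theorem dom_mul [Fintype κ] {A : Matrix ι κ ℂ} {B : Matrix κ ν ℂ} {A' : Matrix ι κ ℝ} {B' : Matrix κ ν ℝ}
    (hA : RLe (cabs A) A') (hB : RLe (cabs B) B') : RLe (cabs (A * B)) (A' * B') :=
  (cabs_mul_le A B).trans
    ((mul_mono_right hA (cabs_nonneg B)).trans (mul_mono_left (rnonneg_of_dom hA) hB))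

/-- Domination is stable under sums and differences. -/
theorem dom_add {A B : Matrix ι κ ℂ} {A' B' : Matrix ι κ ℝ} (hA : RLe (cabs A) A')
    (hB : RLe (cabs B) B') : RLe (cabs (A + B)) (A' + B') :=
  (cabs_add_le A B).trans (hA.add hB)

/-- Domination of a difference. -/
theorem dom_sub {A B : Matrix ι κ ℂ} {A' B' : Matrix ι κ ℝ} (hA : RLe (cabs A) A')
    (hB : RLe (cabs B) B') : RLe (cabs (A - B)) (A' + B') :=
  (cabs_sub_le A B).trans (hA.add hB)

/-- Domination of a negation. -/
theorem dom_neg {A : Matrix ι κ ℂ} {A' : Matrix ι κ ℝ} (hA : RLe (cabs A) A') : RLe (cabs (-A)) A' := by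
  rwa [cabs_neg]

end Basic

section Square

variable {ι : Type*} [Fintype ι]

/-- Real weighted row-sum gain. -/
def RGain (w : ι → ℝ) (K : Matrix ι ι ℝ) (θ : ℝ) : Prop := ∀ m, ∑ j, K m j * w j ≤ θ * w m

/-- The real gain is monotone in the entries. -/
theorem rgain_mono_entry {w : ι → ℝ} {K K' : Matrix ι ι ℝ} {θ : ℝ} (hw : ∀ m, 0 < w m)
    (h : RLe K K') (hK' : RGain w K' θ) : RGain w K θ := fun m =>
  (sum_le_sum fun j _ => mul_le_mul_of_nonneg_right (h m j) (hw j).le).trans (hK' m)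

/-- Powers of a nonnegative matrix are nonnegative. -/
theorem rnonneg_pow [DecidableEq ι] {P : Matrix ι ι ℝ} (hP : RNonneg P) : ∀ N : ℕ, RNonneg (P ^ N)
  | 0 => by
      intro i j
      rw [pow_zero, Matrix.one_apply]
      split_ifs <;> norm_num
  | N + 1 => by
      rw [pow_succ]
      exact rnonneg_mul (rnonneg_pow hP N) hP

/-- `P W ≤ W` with `P ≥ 0` iterates to `P^N W ≤ W`. -/
theorem iter_le [DecidableEq ι] {P W : Matrix ι ι ℝ} (hP : RNonneg P) (h : RLe (P * W) W) :
    ∀ N : ℕ, RLe (P ^ N * W) W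
  | 0 => by rw [pow_zero, Matrix.one_mul]; exact rle_refl W
  | N + 1 => by
      rw [pow_succ', Matrix.mul_assoc]
      exact (mul_mono_left hP (iter_le hP h N)).trans h

/-- Finite maximum principle: if `K ≥ 0` has weighted gain `θ < 1` and `K W ≤ W` entrywise, then `W ≥ 0`. -/
theorem rnonneg_of_mul_le {w : ι → ℝ} {K W : Matrix ι ι ℝ} {θ : ℝ} (hw : ∀ m, 0 < w m)
    (hK : RNonneg K) (hθ : RGain w K θ) (hθ1 : θ < 1) (h : RLe (K * W) W) : RNonneg W := by
  intro i j
  obtain ⟨m₀, -, hm₀⟩ := exists_min_image univ (fun m => W m j / w m) ⟨i, mem_univ i⟩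
  set r := W m₀ j / w m₀ with hr_def
  have hr : ∀ m, r * w m ≤ W m j := fun m => (le_div_iff₀ (hw m)).mp (hm₀ m (mem_univ m))
  have hrm : r * w m₀ = W m₀ j := by rw [hr_def]; exact div_mul_cancel₀ _ (hw m₀).ne'
  by_contra hneg
  rw [not_le] at hneg
  have hr0 : r < 0 := by
    by_contra h0
    rw [not_lt] at h0
    have := hr i
    nlinarith [hw i, mul_nonneg h0 (hw i).le]
  have hrow : ∑ k, K m₀ k * W k j ≤ W m₀ j := by
    have := h m₀ j; simpa only [Matrix.mul_apply] using this
  have h2 : ∑ k, K m₀ k * (r * w k) ≤ ∑ k, K m₀ k * W k j :=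
    sum_le_sum fun k _ => mul_le_mul_of_nonneg_left (hr k) (hK m₀ k)
  have h3 : ∑ k, K m₀ k * (r * w k) = r * ∑ k, K m₀ k * w k := by
    rw [mul_sum]; exact sum_congr rfl fun k _ => by ring
  have h4 : r * (θ * w m₀) ≤ r * ∑ k, K m₀ k * w k := mul_le_mul_of_nonpos_left (hθ m₀) hr0.le
  have key : r * (θ * w m₀) ≤ r * w m₀ := by linarith
  nlinarith [mul_pos (hw m₀) (sub_pos.mpr hθ1), hw m₀]

/-- Vector form: `0 ≤ u ≤ K u` with `RGain w K θ`, `θ < 1` forces `u = 0`. -/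
theorem vec_eq_zero_of_le {w : ι → ℝ} {K : Matrix ι ι ℝ} {θ : ℝ} {u : ι → ℝ} (hw : ∀ m, 0 < w m)
    (hK : RNonneg K) (hθ : RGain w K θ) (hθ1 : θ < 1) (hu0 : ∀ i, 0 ≤ u i)
    (hu : ∀ i, u i ≤ ∑ j, K i j * u j) : u = 0 := by
  classical
  by_cases hι : (univ : Finset ι).Nonempty
  · obtain ⟨m₀, -, hm₀⟩ := exists_max_image univ (fun m => u m / w m) hι
    set r := u m₀ / w m₀ with hr_def
    have hr : ∀ m, u m ≤ r * w m := fun m => (div_le_iff₀ (hw m)).mp (hm₀ m (mem_univ m))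
    have hrm : r * w m₀ = u m₀ := by rw [hr_def]; exact div_mul_cancel₀ _ (hw m₀).ne'
    have hr0 : 0 ≤ r := div_nonneg (hu0 m₀) (hw m₀).le
    have h2 : ∑ k, K m₀ k * u k ≤ ∑ k, K m₀ k * (r * w k) :=
      sum_le_sum fun k _ => mul_le_mul_of_nonneg_left (hr k) (hK m₀ k)
    have h3 : ∑ k, K m₀ k * (r * w k) = r * ∑ k, K m₀ k * w k := by
      rw [mul_sum]; exact sum_congr rfl fun k _ => by ring
    have h4 : r * ∑ k, K m₀ k * w k ≤ r * (θ * w m₀) := mul_le_mul_of_nonneg_left (hθ m₀) hr0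
    have key : u m₀ ≤ r * (θ * w m₀) := by linarith [hu m₀]
    have hr' : r ≤ 0 := by nlinarith [mul_pos (hw m₀) (sub_pos.mpr hθ1), hw m₀]
    have hrz : r = 0 := le_antisymm hr' hr0
    funext m
    have := hr m
    rw [hrz, zero_mul] at this
    exact le_antisymm this (hu0 m)
  · rw [not_nonempty_iff_eq_empty, univ_eq_empty_iff] at hι
    funext m; exact (IsEmpty.false m).elim

/-- `K.mulVec` is monotone for `K ≥ 0`. -/
theorem mulVec_mono {K : Matrix ι ι ℝ} (hK : RNonneg K) {a b : ι → ℝ} (h : ∀ i, a i ≤ b i) :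
    ∀ i, (K.mulVec a) i ≤ (K.mulVec b) i := fun i => by
  simp only [Matrix.mulVec, dotProduct]
  exact sum_le_sum fun j _ => mul_le_mul_of_nonneg_left (h j) (hK i j)

/-- `u ≤ P u` with `P ≥ 0` iterates to `u ≤ P^N u`. -/
theorem vec_iter_le [DecidableEq ι] {P : Matrix ι ι ℝ} (hP : RNonneg P) {u : ι → ℝ} (hu : ∀ i, u i ≤ (P.mulVec u) i) :
    ∀ N : ℕ, ∀ i, u i ≤ ((P ^ N).mulVec u) i
  | 0 => fun i => by rw [pow_zero, Matrix.one_mulVec]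
  | N + 1 => fun i => by
      rw [pow_succ', ← Matrix.mulVec_mulVec]
      exact (hu i).trans (mulVec_mono hP (vec_iter_le hP hu N) i)

end Square

section Resolvent

variable {n : ℕ} {w : Fin n → ℝ}

/-- `Gain` of #252 is the real gain of the entrywise absolute values. -/
theorem gain_iff {A : Matrix (Fin n) (Fin n) ℂ} {q : ℝ} : Gain w A q ↔ RGain w (cabs A) q := Iff.rfl

variable {T S S' E : Matrix (Fin n) (Fin n) ℂ} {U D X : Matrix (Fin n) (Fin n) ℝ} {N : ℕ} {θ : ℝ}

/-- Right resolvent identity for a general perturbation: `S T = 1`, `(T + E) S' = 1` ⇒ `S' = S - S E S'`. -/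
theorem inv_add_right (hST : S * T = 1) (hS' : (T + E) * S' = 1) : S' = S - S * E * S' := by
  have h : S * ((T + E) * S') = S := by rw [hS', Matrix.mul_one]
  rw [← Matrix.mul_assoc, Matrix.mul_add, hST, Matrix.add_mul, Matrix.one_mul] at h
  exact eq_sub_of_add_eq h

/-- Left resolvent identity for a general perturbation: `T S = 1`, `S' (T + E) = 1` ⇒ `S' = S - S' E S`. -/
theorem inv_add_left (hTS : T * S = 1) (hS' : S' * (T + E) = 1) : S' = S - S' * E * S := by
  have h : S' * (T + E) * S = S := by rw [hS', Matrix.one_mul]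
  rw [Matrix.mul_add, Matrix.add_mul, Matrix.mul_assoc S' T S, hTS, Matrix.mul_one] at h
  exact eq_sub_of_add_eq h

/-- Invertibility of the diagonally (or arbitrarily) perturbed matrix from entrywise domination:
`S T = 1`, `|S| ≤ U`, `|E| ≤ D`, and `(U D)^N` has weighted gain `θ < 1`  ⇒  `T + E` is a unit. -/
theorem isUnit_add_of_dom (hw : ∀ m, 0 < w m) (hST : S * T = 1) (hSU : RLe (cabs S) U)
    (hED : RLe (cabs E) D) (hθ : RGain w ((U * D) ^ N) θ) (hθ1 : θ < 1) : IsUnit (T + E) := by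
  rw [← Matrix.mulVec_injective_iff_isUnit]
  intro v v' hvv
  have hd : (T + E).mulVec (v - v') = 0 := by rw [Matrix.mulVec_sub, hvv, sub_self]
  set d := v - v' with hd_def
  have h1 : d = -((S * E).mulVec d) := by
    have h2 : S.mulVec ((T + E).mulVec d) = 0 := by rw [hd, Matrix.mulVec_zero]
    rw [Matrix.mulVec_mulVec, Matrix.mul_add, hST, Matrix.add_mulVec, Matrix.one_mulVec] at h2
    exact eq_neg_of_add_eq_zero_left h2
  have hP : RNonneg (U * D) := rnonneg_mul (rnonneg_of_dom hSU) (rnonneg_of_dom hED)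
  have hdom : RLe (cabs (S * E)) (U * D) := dom_mul hSU hED
  set u : Fin n → ℝ := fun i => ‖d i‖ with hu_def
  have hu : ∀ i, u i ≤ ((U * D).mulVec u) i := by
    intro i
    have h3 : d i = -(∑ j, (S * E) i j * d j) := by
      have := congrFun h1 i
      simpa [Matrix.mulVec, dotProduct] using this
    simp only [hu_def, Matrix.mulVec, dotProduct]
    rw [h3, norm_neg]
    calc ‖∑ j, (S * E) i j * d j‖ ≤ ∑ j, ‖(S * E) i j * d j‖ := norm_sum_le _ _
      _ = ∑ j, ‖(S * E) i j‖ * ‖d j‖ := sum_congr rfl fun j _ => norm_mul _ _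
      _ ≤ ∑ j, (U * D) i j * ‖d j‖ :=
          sum_le_sum fun j _ => mul_le_mul_of_nonneg_right (hdom i j) (norm_nonneg _)
  have hz := vec_eq_zero_of_le hw (rnonneg_pow hP N) hθ hθ1 (fun i => norm_nonneg (d i))
    (fun i => by
      have := vec_iter_le hP hu N i
      simpa [Matrix.mulVec, dotProduct] using this)
  have hd0 : d = 0 := by
    funext i
    have := congrFun hz i
    simpa [hu_def] using this
  exact sub_eq_zero.mp hd0

/-- THEOREM A (entrywise resolvent domination): `|S'| ≤ (1 + X) U` for every super-solution `X` of
`U D + U D X ≤ X` (no sign condition on `X` is needed), when `S T = 1`, `(T + E) S' = 1`, `|S| ≤ U`, `|E| ≤ D` and `(U D)^N` has gain `θ < 1`. -/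
theorem cabs_inv_add_le (hw : ∀ m, 0 < w m) (hST : S * T = 1) (hS' : (T + E) * S' = 1)
    (hSU : RLe (cabs S) U) (hED : RLe (cabs E) D)
    (hX : RLe (U * D + U * D * X) X) (hθ : RGain w ((U * D) ^ N) θ) (hθ1 : θ < 1) :
    RLe (cabs S') ((1 + X) * U) := by
  have hid := inv_add_right hST hS'
  have hU0 : RNonneg U := rnonneg_of_dom hSU
  have hP : RNonneg (U * D) := rnonneg_mul hU0 (rnonneg_of_dom hED)
  -- sub-solution: Y ≤ U + P Y
  have hY : RLe (cabs S') (U + U * D * cabs S') := by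
    have h1 : RLe (cabs S') (cabs S + cabs (S * E * S')) := by
      have h := cabs_sub_le S (S * E * S')
      rwa [← hid] at h
    exact h1.trans (hSU.add (dom_mul (dom_mul hSU hED) (rle_refl _)))
  -- super-solution: U + P V ≤ V with V = (1 + X) U
  have hV : RLe (U + U * D * ((1 + X) * U)) ((1 + X) * U) := by
    have h1 : U * D * ((1 + X) * U) = (U * D + U * D * X) * U := by
      rw [← Matrix.mul_assoc, Matrix.mul_add, Matrix.mul_one]
    have h2 : (1 + X) * U = U + X * U := by rw [Matrix.add_mul, Matrix.one_mul]
    rw [h1, h2]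
    exact (rle_refl U).add (mul_mono_right hX hU0)
  -- comparison W = V - Y satisfies P W ≤ W
  set W := (1 + X) * U - cabs S' with hW
  have hPW : RLe (U * D * W) W := by
    intro i j
    have a := hY i j
    have b := hV i j
    simp only [Matrix.add_apply] at a b
    simp only [hW, Matrix.mul_sub, Matrix.sub_apply]
    linarith
  have hWnn := rnonneg_of_mul_le hw (rnonneg_pow hP N) hθ hθ1 (iter_le hP hPW N)
  intro i j
  have := hWnn i j
  simp only [hW, Matrix.sub_apply] at this
  linarith

end Resolvent

section Loop

variable {n r : ℕ} {w : Fin n → ℝ}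
variable {Ts S S' Es : Matrix (Fin n) (Fin n) ℂ} {Tr R R' Er : Matrix (Fin r) (Fin r) ℂ}
variable {H : Matrix (Fin n) (Fin r) ℂ} {E : Matrix (Fin r) (Fin n) ℂ} {F : Matrix (Fin n) (Fin r) ℂ}
variable {Ys Ds UL : Matrix (Fin n) (Fin n) ℝ} {Yr Dr : Matrix (Fin r) (Fin r) ℝ}

/-- The loop-difference identity: with `S' (T_s + E_s) = 1`, `T_s S = 1`, `R T_r = 1`, `(T_r + E_r) R' = 1` and
`E F = 1`, writing `L = S H R E`, `Z = F E_r R' E`:  `S' H R' E - L = -(S' E_s L) + S' E_s L Z - L Z`. -/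
theorem loop_diff_eq (hTS : Ts * S = 1) (hS' : S' * (Ts + Es) = 1) (hRT : R * Tr = 1)
    (hR' : (Tr + Er) * R' = 1) (hEF : E * F = 1) :
    S' * H * R' * E - S * H * R * E =
      -(S' * Es * (S * H * R * E)) + S' * Es * (S * H * R * E) * (F * Er * R' * E)
        - S * H * R * E * (F * Er * R' * E) := by
  have eS : S' * Es * S = S - S' := by
    have h := inv_add_left hTS hS'
    rw [eq_sub_iff_add_eq] at h
    exact eq_sub_of_add_eq' h
  have eR : R * Er * R' = R - R' := by
    have h := inv_add_right hRT hR'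
    rw [eq_sub_iff_add_eq] at h
    exact eq_sub_of_add_eq' h
  have hEF' : ∀ Y : Matrix (Fin r) (Fin n) ℂ, E * (F * Y) = Y := fun Y => by
    rw [← Matrix.mul_assoc, hEF, Matrix.one_mul]
  have eS' : ∀ Y : Matrix (Fin n) (Fin n) ℂ, S' * (Es * (S * Y)) = S * Y - S' * Y := fun Y => by
    rw [← Matrix.mul_assoc, ← Matrix.mul_assoc, eS, Matrix.sub_mul]
  have eR' : ∀ Y : Matrix (Fin r) (Fin n) ℂ, R * (Er * (R' * Y)) = R * Y - R' * Y := fun Y => by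
    rw [← Matrix.mul_assoc, ← Matrix.mul_assoc, eR, Matrix.sub_mul]
  simp only [Matrix.mul_assoc, hEF', eR', eS', Matrix.mul_sub, Matrix.sub_mul]
  abel

/-- THEOREM B (product-entrywise cell increment): the entrywise bound on `L' - L` behind the engine line `KCELLP`. -/
theorem cabs_loop_diff_le (hTS : Ts * S = 1) (hS' : S' * (Ts + Es) = 1) (hRT : R * Tr = 1)
    (hR' : (Tr + Er) * R' = 1) (hEF : E * F = 1) (hYs : RLe (cabs S') Ys) (hDs : RLe (cabs Es) Ds)
    (hYr : RLe (cabs R') Yr) (hDr : RLe (cabs Er) Dr) (hUL : RLe (cabs (S * H * R * E)) UL) :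
    RLe (cabs (S' * H * R' * E - S * H * R * E))
      (Ys * Ds * UL + Ys * Ds * UL * (cabs F * Dr * Yr * cabs E) + UL * (cabs F * Dr * Yr * cabs E)) := by
  rw [loop_diff_eq hTS hS' hRT hR' hEF]
  have hZ : RLe (cabs (F * Er * R' * E)) (cabs F * Dr * Yr * cabs E) :=
    dom_mul (dom_mul (dom_mul (rle_refl _) hDr) hYr) (rle_refl _)
  have h1 : RLe (cabs (S' * Es * (S * H * R * E))) (Ys * Ds * UL) := dom_mul (dom_mul hYs hDs) hUL
  exact dom_sub (dom_add (dom_neg h1) (dom_mul h1 hZ)) (dom_mul hUL hZ)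

/-- The cell verdict: the loop matrix at the shifted parameters has weighted gain `q'` as soon as the
engine's nonnegative table `U_L + (Y_s D_s U_L + Y_s D_s U_L Z_b + U_L Z_b)` has real gain `q'`. -/
theorem gain_loop_cell (hw : ∀ m, 0 < w m) (hTS : Ts * S = 1) (hS' : S' * (Ts + Es) = 1)
    (hRT : R * Tr = 1) (hR' : (Tr + Er) * R' = 1) (hEF : E * F = 1) (hYs : RLe (cabs S') Ys)
    (hDs : RLe (cabs Es) Ds) (hYr : RLe (cabs R') Yr) (hDr : RLe (cabs Er) Dr)
    (hUL : RLe (cabs (S * H * R * E)) UL) {q' : ℝ}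
    (hq : RGain w (UL + (Ys * Ds * UL + Ys * Ds * UL * (cabs F * Dr * Yr * cabs E)
      + UL * (cabs F * Dr * Yr * cabs E))) q') :
    Gain w (S' * H * R' * E) q' := by
  rw [gain_iff]
  refine rgain_mono_entry hw ?_ hq
  have h : S' * H * R' * E = S * H * R * E + (S' * H * R' * E - S * H * R * E) := by abel
  rw [h]
  exact dom_add hUL (cabs_loop_diff_le hTS hS' hRT hR' hEF hYs hDs hYr hDr hUL)

end Loop

end Summit.AnomalousDissipation.SoloBlind.GainEntrywise
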